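import Summits.KontsevichZagierPeriods.Zeta5Search.WellPoisedFaceZeta579Growth
import Summits.KontsevichZagierPeriods.Zeta5Search.WellPoisedFaceTailSandwich
import HarnessLib

/-!
# ζ(5) search — the odd-window face theorem made HYPOTHESIS-FREE: Lemma 19's normalised forms grow on the whole
numerator-free face of every box `6 ≤ q ≤ 11` (cell `pub-zeta5`, fam-odd gen 8, file C; census item R12 DONE)

HONEST FRAMING: systematic search; no irrationality claim unless certified.  A NEGATIVE result about a printed
construction; nothing here is a candidate or an irrationality claim.

`WellPoisedFaceOddGrowth` (fam-odd gen 6) and `WellPoisedFaceZeta579Growth` (gen 7) prove, for every integral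
direction `E : IntFaceDir M` on the numerator-free face of Zudilin's `r = 3`, `q = M + 5` box [cite: Zudilin2004,
§8 (8.6)–(8.9), Lemma 19, Proposition 5] and every `F : ℕ → ℝ` obeying the DECAY FLOOR
`hF : ∀ ε > 0, ∀ᶠ n, exp(−(C₀+ε)n) ≤ |F n|` (`C₀ = FaceDirM.C0`), that the integer-normalised forms
`Λ_n(F) = D(n) Φ(h_n)⁻¹ F n` satisfy `|Λ_n(F)| ≥ exp((δ − φ⁺ − C₀ − ε)n)` eventually, and `|Λ_n(F)| → +∞` for `M ≤ 6`.
Files A/B of this generation (`WellPoisedFaceTailRate`, `WellPoisedFaceTailSandwich`) prove the decay floor for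
Zudilin's actual face form `F(h_n) = ½ Σ_t R″(t)` with ANY number `B ≥ 3` of tail bricks (`tailF`,
`tailF_abs_decay_floor`, rate `−Σ_j blockRate η₀ η_j`).  This file is the glue (`B = M + 2`,
`Σ_{Fin (M+2)} = a + Σ_mid + d = FaceDirM.C0`):
* `IntFaceDir.faceForm E n := tailF E.η₀ E.tail n` — (8.6) VERBATIM at the ray point `h_n` of `E`;
* `faceForm_pos`, `tendsto_log_faceForm_div : (1/n) log F(h_n) → −C₀`, `faceForm_decay_floor` (= `hF`), `1 ≤ M`;
* **`faceLambda_faceForm_eventually_ge` (`1 ≤ M`, every `ε > 0`): eventually `exp((δ − φ⁺ − C₀ − ε)·n) ≤ |Λ_n|`;**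
* **`faceLambda_faceForm_tendsto_atTop` (`1 ≤ M ≤ 6`, i.e. `6 ≤ q ≤ 11`): `|Λ_n| → +∞`** — no hypothesis left;
  kernel instances `modelFace9Int` (`q = 9`) and `modelFace11Int` (`q = 11`).
So, granted only Lemma 19 [PRINTED: `Λ_n ∈ ℤ + ℤζ(5) + ℤζ(7) + ⋯` for odd `q`; the MEANING of `Λ_n`, used in no
statement], Proposition 5 never applies on the numerator-free face of the boxes with windows `{ζ(5)}` (`q = 7`,
fam-vwp's `WellPoisedFaceGrowth`, re-obtained here with `M = 2`), `{ζ(5), ζ(7)}` (`q = 9`) and `{ζ(5), ζ(7), ζ(9)}`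
(`q = 11`), at any height: the forms grow at rate `≥ η₀/25` (`FaceDirM.face_gap_le_six`).  NOT proved: anything
off the face (interior directions need the numerator saving and the saddle-point rate — the certified-MODEL
programme, families/odd/FAMILY.md §5.2 / SUPKAPPA.md); Lemma 19 itself.  Standard axioms only.
-/

noncomputable section

open Real Finset Filter Topology

namespace Summit.KontsevichZagierPeriods.Zeta5Search

namespace WellPoisedFace

namespace IntFaceDir

open Summit.KontsevichZagierPeriods.Zeta5Search.WellPoisedFaceRate
  (tailF tailF_pos tendsto_log_tailF_div tailF_abs_decay_floor)

variable {M : ℕ} (E : IntFaceDir M)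

/-- `2η_j < η₀` for every tail of an integral face direction. -/
theorem two_tail_lt (j : Fin (M + 2)) : 2 * E.tail j < E.η₀ := by
  have h1 := E.hhi j; have h2 := E.hd; omega

/-- The rate sum over all `M + 2` tails is `FaceDirM.C0 = blockRate η₀ a + Σ_mid blockRate η₀ η_j + blockRate η₀ d`
(split off the first and the last tail). -/
theorem sum_blockRate_tail : ∑ j : Fin (M + 2), blockRate (E.η₀ : ℝ) (E.tail j : ℝ) = E.real.C0 := by
  rw [Fin.sum_univ_castSucc, Fin.sum_univ_succ]
  simp only [Fin.castSucc_zero, FaceDirM.C0, real, a, mid, d]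

/-- Zudilin's face form `F(h_n) = ½ Σ_{t ≥ 0} R″(t)` [(8.6), with `R` = (8.7)·(h₀ + 2t) on the face] at the ray point
`h_n = (η₀n + 2; 1, 1, 1, η₄n + 1, …, η_q n + 1)` of `E`, all `M + 2` tail bricks (`WellPoisedFaceTailRate.tailF`). -/
def faceForm (n : ℕ) : ℝ := tailF E.η₀ E.tail n

/-- `F(h_n) > 0` (`M ≥ 1`, i.e. at least three tail bricks). -/
theorem faceForm_pos (hM : 1 ≤ M) (n : ℕ) : 0 < E.faceForm n :=
  tailF_pos (by omega) E.η₀ E.tail E.two_tail_lt n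

/-- THE BOUNDARY LEMMA over `IntFaceDir`: `(1/n) log F(h_n) → −C₀ = −FaceDirM.C0` (`M ≥ 1`). -/
theorem tendsto_log_faceForm_div (hM : 1 ≤ M) :
    Tendsto (fun n : ℕ => Real.log (E.faceForm n) / n) atTop (𝓝 (-E.real.C0)) := by
  rw [← E.sum_blockRate_tail]
  exact tendsto_log_tailF_div (by omega) E.η₀ E.tail E.two_tail_lt

/-- THE DECAY FLOOR = hypothesis `hF` of `faceLambda_eventually_ge`, discharged (`M ≥ 1`): for every `ε > 0`,
eventually `exp(−(C₀ + ε)·n) ≤ |F(h_n)|`. -/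
theorem faceForm_decay_floor (hM : 1 ≤ M) (ε : ℝ) (hε : 0 < ε) :
    ∀ᶠ n : ℕ in atTop, Real.exp (-(E.real.C0 + ε) * n) ≤ |E.faceForm n| := by
  have h := tailF_abs_decay_floor (B := M + 2) (by omega) E.η₀ E.tail E.two_tail_lt ε hε
  rw [E.sum_blockRate_tail] at h
  exact h

/-- **GROWTH FLOOR, HYPOTHESIS-FREE (`M ≥ 1`, every `q ≥ 6`).** For every `ε > 0`, eventually
`exp((δ − φ⁺ − C₀ − ε)·n) ≤ |Λ_n(F(h_·))|`, `Λ_n = D(n)·Φ(h_n)⁻¹·F(h_n)` (`faceLambda`: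
`D(n) = D_{M₁}³ D_{M₂} ⋯ D_{M_{q−3}}` VERBATIM, `Φ` = (8.9) VERBATIM, `F` = (8.6) VERBATIM). -/
theorem faceLambda_faceForm_eventually_ge (hM : 1 ≤ M) {ε : ℝ} (hε : 0 < ε) :
    ∀ᶠ n : ℕ in atTop,
      Real.exp ((E.real.delta - E.real.phiPlus - E.real.C0 - ε) * n) ≤ |E.faceLambda E.faceForm n| :=
  E.faceLambda_eventually_ge E.faceForm (E.faceForm_decay_floor hM) hε

/-- **THE ODD-WINDOW FACE THEOREM, HYPOTHESIS-FREE (`1 ≤ M ≤ 6`, i.e. `6 ≤ q ≤ 11`: windows `{ζ(5)}`, `{ζ(5), ζ(7)}`,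
`{ζ(5), ζ(7), ζ(9)}`).**  On every integral direction of the numerator-free face, `|Λ_n(F(h_·))| → +∞` (exponent
`δ − φ⁺ − C₀ ≥ η₀/25`, `FaceDirM.face_gap_le_six`).  By Lemma 19 [PRINTED] these `Λ_n` are Zudilin's
integer-normalised linear forms in `1` and the odd zeta values of the window; growing forms prove nothing, and
Proposition 5 never applies on the face, at any height. -/
theorem faceLambda_faceForm_tendsto_atTop (hM1 : 1 ≤ M) (hM : M ≤ 6) :
    Tendsto (fun n : ℕ => |E.faceLambda E.faceForm n|) atTop atTop :=
  E.faceLambda_tendsto_atTop_le_six hM E.faceForm (E.faceForm_decay_floor hM1)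

/-! ### Kernel instances: the MODEL maximiser shapes of the `q = 9` and `q = 11` faces, now unconditionally -/

/-- `(93; 0,0,0, 22,25,28,31,34,37)` (`q = 9`, window `{ζ(5), ζ(7)}`): the normalised face forms grow. -/
example : Tendsto (fun n : ℕ => |modelFace9Int.faceLambda modelFace9Int.faceForm n|) atTop atTop :=
  modelFace9Int.faceLambda_faceForm_tendsto_atTop (by norm_num) (by norm_num)

/-- `(200; 0,0,0, 42,43,…,48,71)` (`q = 11`, window `{ζ(5), ζ(7), ζ(9)}`): the normalised face forms grow. -/
example : Tendsto (fun n : ℕ => |modelFace11Int.faceLambda modelFace11Int.faceForm n|) atTop atTop :=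
  modelFace11Int.faceLambda_faceForm_tendsto_atTop (by norm_num) le_rfl

end IntFaceDir

end WellPoisedFace

end Summit.KontsevichZagierPeriods.Zeta5Search

end
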